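import Mathlib
import Literature.NumberTheory.Sieve.RoughOmegaCellsAsymptoticDensity
import Summits.Parity.GeneralizedHardyLittlewood.Theorems.ParityLeakOneFifthPlainSplitTwistedCellSieve
import HarnessLib

/-!
# Route ParityLeakOneFifth, crux `PlainSplit` (stmt-Parity-18382), skeleton `calib-split`:
# stub `stub_twistedBoundaryUpper` — the boundary `Ω = 2` cell above `D = x^{1/2−2ε}` is `O(ε)`

For `0 < ε ≤ 1/25` and large `x`, the `z`-rough `n ∈ (x, 2x]` (`z = exp((log log x)²)`) with
`P⁻(n+2) > D = x^{1/2−2ε}` and `Ω(n+2) = 2` number at most `C ε·V_sh·x/log x`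
(`V_sh = ∏_{2<p<z}(1 − 1/(p−1))`).  Proof: the sieve step `twistedCell_sieve_le` (level `L = z`,
cell `Ω = 2` of the `D`-rough integers; FL + Bombieri–Vinogradov for the cells) bounds the count by
`#Φ₂(2x+2, D)·V_sh·(1 + C₁/e) + O(x/log²x)`, and Alladi's asymptotic
(`exists_abs_roughCell_sub_main_le`, density `I₂(u) = log(u−1)`, `u = log(2x+2)/log D`) gives
`#Φ₂(2x+2, D) ≤ (2x+2)·log(u−1)/log(2x+2) + O(x/log²x)` with `log(u − 1) ≤ 5ε/(1/2−2ε) ≤ 12ε`.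
-/

namespace Summit.Parity.GeneralizedHardyLittlewood.Theorems.ParityLeakOneFifth

open Finset Real
open scoped ArithmeticFunction.Omega Classical
open Literature.NumberTheory.Sieve

/-- The arithmetic of `stub_twistedBoundaryUpper` over real variables. -/
theorem twistedBoundary_arith {C₁ ε V x L B sz cell main errA errBV : ℝ} (hC₁ : 0 < C₁)
    (hε : 0 < ε) (hV : 0 ≤ V) (hx : 0 < x) (hL : 0 < L)
    (hB : B ≤ sz * V * (1 + C₁ * Real.exp (-1)) + errBV) (hsz : sz ≤ cell)
    (hcell : cell ≤ main + errA) (hmain : main ≤ 48 * ε * x / L) (herrA : errA ≤ ε * x / L)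
    (herrBV : errBV ≤ ε * V * x / L) : B ≤ 200 * (1 + C₁) * ε * V * x / L := by
  have he : Real.exp (-1) ≤ 1 := by
    have := Real.exp_le_exp.2 (show (-1 : ℝ) ≤ 0 by norm_num); rwa [Real.exp_zero] at this
  have h1 : 1 + C₁ * Real.exp (-1) ≤ 1 + C₁ := by nlinarith [Real.exp_pos (-1 : ℝ)]
  have h2 : sz ≤ 49 * ε * x / L := by
    have e : 48 * ε * x / L + ε * x / L = 49 * ε * x / L := by ring
    linarith
  have h3 : sz * V * (1 + C₁ * Real.exp (-1)) ≤ (49 * ε * x / L) * V * (1 + C₁) := by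
    have hpos : 0 ≤ 1 + C₁ * Real.exp (-1) := by positivity
    calc sz * V * (1 + C₁ * Real.exp (-1)) ≤ (49 * ε * x / L) * V * (1 + C₁ * Real.exp (-1)) := by
          gcongr
      _ ≤ (49 * ε * x / L) * V * (1 + C₁) := by gcongr
  have h4 : (49 * ε * x / L) * V * (1 + C₁) + ε * V * x / L ≤ 200 * (1 + C₁) * ε * V * x / L := by
    have hq : 0 ≤ ε * V * x / L := by positivity
    have : (49 * ε * x / L) * V * (1 + C₁) + ε * V * x / L =
        (49 * (1 + C₁) + 1) * (ε * V * x / L) := by ring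
    rw [this, show 200 * (1 + C₁) * ε * V * x / L = (200 * (1 + C₁)) * (ε * V * x / L) by ring]
    exact mul_le_mul_of_nonneg_right (by nlinarith) hq
  linarith

/-- Error term of Alladi's asymptotic: `CA·X/log²D ≤ ε x/log x` once `23 CA ≤ ε log x`
(`X ≤ 4x`, `log D = (1/2 − 2ε) log x`, `ε ≤ 1/25`). -/
theorem boundary_errA_le {CA ε x X E : ℝ} (hCA : 0 ≤ CA) (hε : 0 < ε) (hε25 : ε ≤ 1 / 25)
    (hx : 0 ≤ x) (hX : X ≤ 4 * x) (hE0 : 0 < E) (hkey : 23 * CA ≤ ε * E) :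
    CA * X / ((1 / 2 - 2 * ε) * E) ^ 2 ≤ ε * x / E := by
  have hα0 : (21 : ℝ) / 50 ≤ 1 / 2 - 2 * ε := by linarith
  have hα : (0 : ℝ) < 1 / 2 - 2 * ε := by linarith
  have hq : 0 < ((1 / 2 - 2 * ε) * E) ^ 2 := by positivity
  rw [div_le_div_iff₀ hq hE0]
  have hsq : (21 / 50 : ℝ) ^ 2 * E ^ 2 ≤ ((1 / 2 - 2 * ε) * E) ^ 2 := by
    rw [mul_pow]
    exact mul_le_mul_of_nonneg_right (pow_le_pow_left₀ (by norm_num) hα0 2) (by positivity)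
  calc CA * X * E ≤ CA * (4 * x) * E := by gcongr
    _ = (4 * CA) * (x * E) := by ring
    _ ≤ (ε * E * (21 / 50) ^ 2) * (x * E) := by
        refine mul_le_mul_of_nonneg_right ?_ (by positivity); linarith
    _ = ε * x * ((21 / 50 : ℝ) ^ 2 * E ^ 2) := by ring
    _ ≤ ε * x * ((1 / 2 - 2 * ε) * E) ^ 2 := by gcongr

/-- Error term of the cells' Bombieri–Vinogradov: `2·C₂·4x/log²x ≤ ε V x/log x` once
`8(C₂+1)t⁴ ≤ ε c log x` and `V ≥ c/t⁴` (`t = log log x`). -/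
theorem boundary_errBV_le {C₂ c ε x t E V : ℝ} (hε : 0 < ε)
    (hx : 0 ≤ x) (ht : 0 < t) (hE0 : 0 < E) (hV : c / t ^ 4 ≤ V)
    (hkey : 8 * (C₂ + 1) * t ^ 4 ≤ ε * c * E) :
    2 * (C₂ * (4 * x) / E ^ 2) ≤ ε * V * x / E := by
  have ht4 : 0 < t ^ 4 := by positivity
  have hfin : 2 * (C₂ * (4 * x) / E ^ 2) ≤ ε * (c / t ^ 4) * x / E := by
    rw [show 2 * (C₂ * (4 * x) / E ^ 2) = (2 * (C₂ * (4 * x))) / E ^ 2 by ring,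
      div_le_div_iff₀ (pow_pos hE0 2) hE0]
    have h5 : 8 * C₂ ≤ ε * (c / t ^ 4) * E := by
      rw [show ε * (c / t ^ 4) * E = (ε * c * E) / t ^ 4 by ring, le_div_iff₀ ht4]
      have : 0 ≤ 8 * t ^ 4 := by positivity
      linarith [hkey]
    calc 2 * (C₂ * (4 * x)) * E = (8 * C₂) * (x * E) := by ring
      _ ≤ (ε * (c / t ^ 4) * E) * (x * E) := mul_le_mul_of_nonneg_right h5 (by positivity)
      _ = ε * (c / t ^ 4) * x * E ^ 2 := by ring
  have hV' : ε * (c / t ^ 4) * x / E ≤ ε * V * x / E := by gcongr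
  linarith

set_option maxHeartbeats 400000 in
/-- **Stub `stub_twistedBoundaryUpper` of skeleton `calib-split` of crux `PlainSplit`** (registered
signature, verbatim): there are `C` and `ε₀ > 0` (`ε₀ = 1/25`) such that for `0 < ε ≤ ε₀` and large
`x`, the `z`-rough `n ∈ (x, 2x]` with `P⁻(n+2) > x^{1/2−2ε}` and `Ω(n+2) = 2` number at most
`C ε·V_sh·x/log x`.  Sieve step `twistedCell_sieve_le` at level `z` + Alladi's asymptotic for the
cell `Ω = 2` of the `x^{1/2−2ε}`-rough integers (`I₂(u) = log(u−1) ≤ 12ε`). -/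
theorem stub_twistedBoundaryUpper : ∃ C : ℝ, 0 < C ∧ ∃ ε₀ : ℝ, 0 < ε₀ ∧ ∀ ε : ℝ, 0 < ε → ε ≤ ε₀ → ∃ x₀ : ℕ, ∀ x : ℕ, x₀ ≤ x → ∀ (z Vsh : ℝ), z = Real.exp (Real.log (Real.log (x : ℝ)) ^ 2) → Vsh = ∏ p ∈ (Finset.range ⌈z⌉₊).filter (fun p : ℕ => p.Prime ∧ p ≠ 2), (1 - 1 / ((p : ℝ) - 1)) → (#((Finset.Ioc x (2 * x)).filter (fun n : ℕ => (∀ p ∈ n.primeFactors, z ≤ (p : ℝ)) ∧ (x : ℝ) ^ ((1 : ℝ) / 2 - 2 * ε) < ((n + 2).minFac : ℝ) ∧ ArithmeticFunction.cardFactors (n + 2) = 2)) : ℝ) ≤ C * ε * Vsh * (x : ℝ) / Real.log (x : ℝ) := by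
  obtain ⟨C₁, C₂, hC₁, hC₂, hTC⟩ := twistedCell_sieve_le 1 3 2
  obtain ⟨CA, hCA, hAl⟩ := exists_abs_roughCell_sub_main_le 1 3
  obtain ⟨c, hc, hVshlow⟩ := exists_Vsh_lower
  refine ⟨200 * (1 + C₁), by positivity, 1 / 25, by norm_num, ?_⟩
  intro ε hε hε25
  have hα0 : (21 : ℝ) / 50 ≤ 1 / 2 - 2 * ε := by linarith
  have hα1 : 1 / 2 - 2 * ε ≤ (1 : ℝ) / 2 := by linarith
  -- growth in `t = log log x`
  obtain ⟨T₁, hT₁1, hT₁⟩ := exists_quadratic_le_exp 4 0 0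
  set M : ℝ := max 6 (max (Real.log 4 / ε) (23 * CA / ε)) with hM
  have hM6 : (6 : ℝ) ≤ M := le_max_left _ _
  have hM4 : Real.log 4 / ε ≤ M := (le_max_left _ _).trans (le_max_right _ _)
  have hMCA : 23 * CA / ε ≤ M := (le_max_right _ _).trans (le_max_right _ _)
  obtain ⟨T₂, -, hT₂⟩ := exists_quadratic_le_exp 0 0 M
  obtain ⟨T₃, -, hT₃⟩ := exists_pow_four_le_mul_exp (κ := ε * c / (8 * (C₂ + 1))) (by positivity)
  obtain ⟨x₁, hx₁⟩ := exists_nat_loglog_ge (max T₁ (max T₂ T₃))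
  refine ⟨x₁, fun x hx => ?_⟩
  rintro z Vsh rfl rfl
  obtain ⟨hxE, hlogx, hTt⟩ := hx₁ x hx
  set t : ℝ := Real.log (Real.log (x : ℝ)) with ht
  have hT₁t : T₁ ≤ t := le_trans (le_max_left _ _) hTt
  have hT₂t : T₂ ≤ t := le_trans ((le_max_left _ _).trans (le_max_right _ _)) hTt
  have hT₃t : T₃ ≤ t := le_trans ((le_max_right _ _).trans (le_max_right _ _)) hTt
  have ht1 : 1 ≤ t := hT₁1.trans hT₁t
  have ht0 : 0 ≤ t := by linarith
  have hx0 : (0 : ℝ) < x := (Real.exp_pos _).trans_le hxE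
  have hx1 : (1 : ℝ) ≤ x := (Real.one_le_exp (Real.exp_pos _).le).trans hxE
  have hlogpos : 0 < Real.log (x : ℝ) := (Real.exp_pos _).trans_le hlogx
  have hexpt : Real.exp t = Real.log (x : ℝ) := by rw [ht, Real.exp_log hlogpos]
  have hxexp : Real.exp (Real.exp t) = (x : ℝ) := by rw [hexpt, Real.exp_log hx0]
  -- consequences of the growth conditions
  have hEM : M ≤ Real.exp t := by have := hT₂ t hT₂t; linarith
  have hE6 : (6 : ℝ) ≤ Real.exp t := hM6.trans hEM
  have hE4 : Real.log 4 / ε ≤ Real.exp t := hM4.trans hEM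
  have hECA : 23 * CA / ε ≤ Real.exp t := hMCA.trans hEM
  set z : ℝ := Real.exp (t ^ 2) with hz
  have hz0 : 0 < z := Real.exp_pos _
  have hz2 : 2 < z := by
    have h1 : Real.exp 1 ≤ z := Real.exp_le_exp.2 (by nlinarith)
    have h2 : (2 : ℝ) < Real.exp 1 := by have := Real.exp_one_gt_d9; linarith
    linarith
  have hlogz : Real.log z = t ^ 2 := by rw [hz, Real.log_exp]
  set D : ℝ := (x : ℝ) ^ ((1 : ℝ) / 2 - 2 * ε) with hD
  have hlogD : Real.log D = (1 / 2 - 2 * ε) * Real.exp t := by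
    rw [hD, Real.log_rpow hx0, hexpt]
  have hD0 : 0 < D := Real.rpow_pos_of_pos hx0 _
  have hDexp : D = Real.exp ((1 / 2 - 2 * ε) * Real.exp t) := by
    rw [← Real.exp_log hD0, hlogD]
  have hzD : z ≤ D := by
    rw [hDexp, hz]; refine Real.exp_le_exp.2 ?_
    have h1 := hT₁ t hT₁t
    have h2 := mul_le_mul_of_nonneg_right (show (1 : ℝ) / 4 ≤ 1 / 2 - 2 * ε by linarith)
      (Real.exp_pos t).le
    linarith
  have hz4 : z ≤ ((x : ℝ) + 2) ^ ((1 : ℝ) / 4) := by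
    have h1 : z ≤ (x : ℝ) ^ ((1 : ℝ) / 4) := by
      rw [hz, ← hxexp, ← Real.exp_mul]; refine Real.exp_le_exp.2 ?_
      have := hT₁ t hT₁t; linarith
    exact h1.trans (Real.rpow_le_rpow hx0.le (by linarith) (by norm_num))
  have hD2 : 2 ≤ D := by linarith
  have hDx : D ≤ (x : ℝ) + 2 := by
    have : D ≤ (x : ℝ) := by
      rw [hD]; calc (x : ℝ) ^ ((1 : ℝ) / 2 - 2 * ε) ≤ (x : ℝ) ^ (1 : ℝ) :=
            Real.rpow_le_rpow_of_exponent_le hx1 (by linarith)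
        _ = x := Real.rpow_one _
    linarith
  have hlog4 : Real.log (2 * (x : ℝ) + 2) ≤ Real.log 4 + Real.log x := by
    rw [← Real.log_mul (by norm_num) hx0.ne']; exact Real.log_le_log (by positivity) (by linarith)
  have hl4 : Real.log 4 ≤ 2 := by
    have := Real.log_two_lt_d9
    rw [show (4 : ℝ) = 2 ^ 2 by norm_num, Real.log_pow]; push_cast; linarith
  have hl40 : 0 < Real.log 4 := Real.log_pos (by norm_num)
  have hlogXε : Real.log (2 * (x : ℝ) + 2) ≤ (1 + ε) * Real.exp t := by
    have : Real.log 4 ≤ ε * Real.exp t := by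
      rw [div_le_iff₀ hε] at hE4; linarith
    rw [← hexpt] at hlog4; linarith
  have hlog3 : Real.log (2 * (x : ℝ) + 2) ≤ (3 : ℕ) * Real.log D := by
    rw [hlogD]
    have hcoef : 1 + ε ≤ 3 * (1 / 2 - 2 * ε) := by linarith
    have h := mul_le_mul_of_nonneg_right hcoef (Real.exp_pos t).le
    push_cast
    calc Real.log (2 * (x : ℝ) + 2) ≤ (1 + ε) * Real.exp t := hlogXε
      _ ≤ 3 * (1 / 2 - 2 * ε) * Real.exp t := h
      _ = (3 : ℝ) * ((1 / 2 - 2 * ε) * Real.exp t) := by ring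
  -- `V_sh`
  set Vsh : ℝ := ∏ p ∈ (Finset.range ⌈z⌉₊).filter (fun p : ℕ => p.Prime ∧ p ≠ 2),
    (1 - 1 / ((p : ℝ) - 1)) with hVsh
  have hVshc : c / t ^ 4 ≤ Vsh := by
    have h := hVshlow z hz2; rw [hlogz, show (t ^ 2) ^ 2 = t ^ 4 by ring] at h; exact h
  have ht4 : 0 < t ^ 4 := by positivity
  have hVsh0 : 0 < Vsh := lt_of_lt_of_le (div_pos hc ht4) hVshc
  -- the density `I₂(u) = log(u − 1) ≤ 12 ε`
  set u : ℝ := Real.log ((2 * x + 2 : ℕ) : ℝ) / Real.log D with hu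
  have hlogDpos : 0 < Real.log D := by rw [hlogD]; positivity
  have hlogX : Real.exp t ≤ Real.log ((2 * x + 2 : ℕ) : ℝ) := by
    rw [hexpt]; push_cast; exact Real.log_le_log hx0 (by linarith)
  have hu2 : 2 ≤ u := by
    rw [hu, le_div_iff₀ hlogDpos, hlogD]
    have := mul_le_mul_of_nonneg_right (show 2 * (1 / 2 - 2 * ε) ≤ (1 : ℝ) by linarith)
      (Real.exp_pos t).le
    linarith
  have hu1 : u - 1 ≤ 1 + 12 * ε := by
    have h1 : u ≤ (1 + ε) / (1 / 2 - 2 * ε) := by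
      rw [hu, div_le_div_iff₀ hlogDpos (by linarith), hlogD]
      have hX : Real.log ((2 * x + 2 : ℕ) : ℝ) ≤ (1 + ε) * Real.exp t := by push_cast; exact hlogXε
      have := mul_le_mul_of_nonneg_right hX (by linarith : (0 : ℝ) ≤ 1 / 2 - 2 * ε)
      linarith
    have h2 : (1 + ε) / (1 / 2 - 2 * ε) ≤ 2 + 12 * ε := by
      rw [div_le_iff₀ (by linarith)]
      have : 0 ≤ ε * (1 - 24 * ε) := mul_nonneg hε.le (by linarith)
      linarith
    linarith
  have hI2 : roughCellDensity (1 + 1) u ≤ 12 * ε := by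
    rw [show (1 : ℕ) + 1 = 2 from rfl, roughCellDensity_two_of_two_le hu2]
    have := Real.log_le_sub_one_of_pos (show 0 < u - 1 by linarith)
    linarith
  -- main term and error terms
  have hX4 : ((2 * x + 2 : ℕ) : ℝ) ≤ 4 * x := by push_cast; linarith
  have hmain : ((2 * x + 2 : ℕ) : ℝ) * roughCellDensity (1 + 1) u / Real.log ((2 * x + 2 : ℕ) : ℝ) ≤
      48 * ε * x / Real.log x := by
    rw [← hexpt]
    have hlX0 : 0 < Real.log ((2 * x + 2 : ℕ) : ℝ) := (Real.exp_pos t).trans_le hlogX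
    have hnum : ((2 * x + 2 : ℕ) : ℝ) * roughCellDensity (1 + 1) u ≤ (4 * x) * (12 * ε) :=
      mul_le_mul hX4 hI2 (roughCellDensity_nonneg _ _) (by positivity)
    calc ((2 * x + 2 : ℕ) : ℝ) * roughCellDensity (1 + 1) u / Real.log ((2 * x + 2 : ℕ) : ℝ)
        ≤ (4 * x) * (12 * ε) / Real.log ((2 * x + 2 : ℕ) : ℝ) :=
          div_le_div_of_nonneg_right hnum hlX0.le
      _ ≤ (4 * x) * (12 * ε) / Real.exp t :=
          div_le_div_of_nonneg_left (by positivity) (Real.exp_pos t) hlogX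
      _ = 48 * ε * x / Real.exp t := by ring
  have herrA : CA * ((2 * x + 2 : ℕ) : ℝ) / Real.log D ^ 2 ≤ ε * x / Real.log x := by
    rw [hlogD, ← hexpt]
    have hkey : 23 * CA ≤ ε * Real.exp t := by rw [div_le_iff₀ hε] at hECA; linarith
    exact boundary_errA_le hCA hε hε25 hx0.le hX4 (Real.exp_pos t) hkey
  have herrBV : C₂ * (2 * (x : ℝ) + 2) / Real.log (2 * (x : ℝ) + 2) ^ (2 : ℝ) +
      C₂ * ((x : ℝ) + 2) / Real.log ((x : ℝ) + 2) ^ (2 : ℝ) ≤ ε * Vsh * x / Real.log x := by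
    have h3 := hT₃ t hT₃t
    have hE0 := Real.exp_pos t
    have hl1 : Real.exp t ≤ Real.log ((x : ℝ) + 2) := by
      rw [hexpt]; exact Real.log_le_log hx0 (by linarith)
    have hl2 : Real.exp t ≤ Real.log (2 * (x : ℝ) + 2) := by
      rw [hexpt]; exact Real.log_le_log hx0 (by linarith)
    have hb1 : C₂ * ((x : ℝ) + 2) / Real.log ((x : ℝ) + 2) ^ (2 : ℝ) ≤
        C₂ * (4 * x) / Real.exp t ^ 2 := by
      rw [Real.rpow_two]
      calc C₂ * ((x : ℝ) + 2) / Real.log ((x : ℝ) + 2) ^ 2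
          ≤ C₂ * (4 * x) / Real.log ((x : ℝ) + 2) ^ 2 := by gcongr; linarith
        _ ≤ C₂ * (4 * x) / Real.exp t ^ 2 :=
            div_le_div_of_nonneg_left (by positivity) (pow_pos hE0 2) (pow_le_pow_left₀ hE0.le hl1 2)
    have hb2 : C₂ * (2 * (x : ℝ) + 2) / Real.log (2 * (x : ℝ) + 2) ^ (2 : ℝ) ≤
        C₂ * (4 * x) / Real.exp t ^ 2 := by
      rw [Real.rpow_two]
      calc C₂ * (2 * (x : ℝ) + 2) / Real.log (2 * (x : ℝ) + 2) ^ 2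
          ≤ C₂ * (4 * x) / Real.log (2 * (x : ℝ) + 2) ^ 2 := by gcongr; linarith
        _ ≤ C₂ * (4 * x) / Real.exp t ^ 2 :=
            div_le_div_of_nonneg_left (by positivity) (pow_pos hE0 2) (pow_le_pow_left₀ hE0.le hl2 2)
    have hkey : 8 * (C₂ + 1) * t ^ 4 ≤ ε * c * Real.exp t := by
      have := mul_le_mul_of_nonneg_left h3 (by positivity : (0 : ℝ) ≤ 8 * (C₂ + 1))
      have e : 8 * (C₂ + 1) * (ε * c / (8 * (C₂ + 1)) * Real.exp t) = ε * c * Real.exp t := by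
        field_simp
      linarith [e.symm.le]
    rw [← hexpt]
    have hfin := boundary_errBV_le hε hx0.le (by linarith) hE0 hVshc hkey
    linarith
  -- the sieve step at level `L = z`
  have hTw := hTC x z z D hz2 le_rfl hzD hDx hlog3 hz4
  rw [show Real.log z / Real.log z = 1 from div_self (by rw [hlogz]; positivity)] at hTw
  -- `B₂ ⊆` the twisted cell
  have hsubB : (Finset.Ioc x (2 * x)).filter (fun n : ℕ => (∀ p ∈ n.primeFactors, z ≤ (p : ℝ)) ∧
      (x : ℝ) ^ ((1 : ℝ) / 2 - 2 * ε) < ((n + 2).minFac : ℝ) ∧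
        ArithmeticFunction.cardFactors (n + 2) = 2) ⊆
      (Finset.Ioc x (2 * x)).filter (fun m : ℕ => (∀ p ∈ m.primeFactors, z ≤ (p : ℝ)) ∧
        ⌈D⌉₊ ≤ (m + 2).minFac ∧ ArithmeticFunction.cardFactors (m + 2) = 1 + 1) := by
    intro n hn
    rw [Finset.mem_filter] at hn ⊢
    refine ⟨hn.1, hn.2.1, Nat.ceil_le.2 hn.2.2.1.le, hn.2.2.2⟩
  have hB : (#((Finset.Ioc x (2 * x)).filter (fun n : ℕ => (∀ p ∈ n.primeFactors, z ≤ (p : ℝ)) ∧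
      (x : ℝ) ^ ((1 : ℝ) / 2 - 2 * ε) < ((n + 2).minFac : ℝ) ∧
        ArithmeticFunction.cardFactors (n + 2) = 2)) : ℝ) ≤ _ :=
    le_trans (by exact_mod_cast Finset.card_le_card hsubB) hTw
  -- the cell counts
  set cell2 : ℝ := ((#((roughIcc ⌈D⌉₊ (2 * x + 2)).filter
    (fun b => ArithmeticFunction.cardFactors b = 1 + 1)) : ℕ) : ℝ) with hcell2
  set cell1 : ℝ := ((#((roughIcc ⌈D⌉₊ (x + 2)).filter
    (fun b => ArithmeticFunction.cardFactors b = 1 + 1)) : ℕ) : ℝ) with hcell1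
  have hsz : cell2 - cell1 ≤ cell2 := by
    have : 0 ≤ cell1 := by rw [hcell1]; exact Nat.cast_nonneg _
    linarith only [this]
  -- Alladi at height `2x+2`
  have hX2 : D ≤ ((2 * x + 2 : ℕ) : ℝ) := by push_cast; linarith only [hDx]
  have hlogk : Real.log ((2 * x + 2 : ℕ) : ℝ) ≤ (3 : ℕ) * Real.log D := by push_cast; exact hlog3
  have hA2 := hAl ((2 * x + 2 : ℕ) : ℝ) D hD2 hX2 hlogk
  rw [Nat.floor_natCast] at hA2
  simp only [show (1 : ℕ) ≠ 0 from one_ne_zero, if_false, sub_zero] at hA2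
  have hcell : cell2 ≤ ((2 * x + 2 : ℕ) : ℝ) * roughCellDensity (1 + 1)
      (Real.log ((2 * x + 2 : ℕ) : ℝ) / Real.log D) / Real.log ((2 * x + 2 : ℕ) : ℝ) +
      CA * ((2 * x + 2 : ℕ) : ℝ) / Real.log D ^ 2 := by
    have h := (abs_le.1 hA2).2; rw [hcell2]; linarith only [h]
  -- assemble
  exact twistedBoundary_arith hC₁ hε hVsh0.le hx0 hlogpos hB hsz hcell hmain herrA herrBV

end Summit.Parity.GeneralizedHardyLittlewood.Theorems.ParityLeakOneFifth
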